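import Mathlib
import Literature.Probability.LatticeModels.CriticalTwoPointBounds
import Literature.Probability.LatticeModels.TwoPointSupNormMonotone
import Literature.Probability.LatticeModels.HighDimPointwiseTriviality
import Literature.Probability.LatticeModels.SharpnessProofs
import Summits.CriticalPhenomena.Ising3DConformalLimit.Theorems.MirrorHoelderCompactnessCompactnessGlueTwoPoint
import HarnessLib

/-!
# Stub `stub_nonSaturationOfHeavyTail` of line `diffusive-branch-is-nonsaturation` (crux
# `PrecisionLaplacian.DirectCorrelationStableTail`, stmt-CriticalPhenomena-4799): non-saturation of
# the infrared bound from a heavy-tailed precision row (flux argument)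

**Statement** (registered text, = `stub_nonSaturationOfHeavyTail` of the lead's skeleton).  Write
`G = criticalTwoPoint 3 = ⟨σ₀σ_x⟩⁺_{β_c(3)}` and `B_R = box 3 R = {−R,…,R}³`.  Let `a ∈ ℓ¹(ℤ³)` with
`Σ a = 0`, `a ≥ 0` off `0`, `Σ_y a(y) G(z − y) = −δ_{z0}` (the precision row), assume box capture
`Σ_{z∈B_R} G(z+v) ≤ Σ_{z∈B_R} G(z)` and a heavy shell mass `Σ_{y ∈ B_{2ρ} ∖ B_ρ} a(y) ≥ c ρ^{−κ}`
for `ρ ≥ ρ₀`, with `κ < 2`, `c > 0`.  Then for every `ε > 0`, frequently in `n`, `n G(n e₀) < ε`.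

**Proof** (all sums over boxes are finite; only the `a`-series is a `tsum`).
* Flux bound (`nonSatHeavyTail_flux`): with `F_R(w) = Σ_{z∈B_R} G(z+w)`, summing the precision
  identity over `z ∈ B_R` and using `Σ a = 0` gives `Σ_y a(y)(F_R(0) − F_R(−y)) = 1` with nonnegative
  terms (box capture, `a ≥ 0` off `0`), so every finite partial sum is `≤ 1`.
* Saturation `ε ≤ n G(n e₀)` for `n ≥ N` gives `ε ≤ 3‖w‖_∞ G(w)` once `3‖w‖_∞ ≥ N`
  (Messager–Miracle-Solé comparison `G(3‖w‖_∞ e₀) ≤ G(w)`, `twoPointPlus_le_of_mul_supNorm_le` with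
  the landed `MirrorHoelderCompactnessGlue.le_supNorm_single`), whence
  `F_R(0) ≥ 2R²ε` for `R ≥ 2N+1` (`nonSatHeavyTail_lower`, the shell `B_R ∖ B_N` has `≥ 7R³` sites).
* The infrared ceiling `‖x‖_∞ G(x) ≤ C₁` (`criticalTwoPoint_bounds_holds`) gives
  `(K−1) F_R(−y) ≤ 27 R² C₁` for `‖y‖_∞ ≥ KR+1` (`nonSatHeavyTail_far`).
* With `K` so large that `27 C₁ ≤ (K−2)ε`, every `y` of the shell `B_{2KR} ∖ B_{KR}` has
  `F_R(0) − F_R(−y) ≥ R²ε`, so `1 ≥ R²ε · c (KR)^{−κ} = (ε c K^{−κ}) R^{2−κ} → ∞`: contradiction.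

Pure theorem file, no definitions, no `sorry`.  References: A. Messager, S. Miracle-Solé,
J. Stat. Phys. 17 (1977) 245 [MessagerMiracleSoleJSP1977]; J. Fröhlich, B. Simon, T. Spencer,
Comm. Math. Phys. 50 (1976) 79 [FrohlichSimonSpencer1976]; H. Duminil-Copin, *Lectures on the Ising
and Potts models on the hypercubic lattice* (2019), Thm. 4.8 and §4.3 [DuminilCopin2019].
-/

noncomputable section

namespace Summit.CriticalPhenomena.Ising3DConformalLimit.Cruxes.DirectCorrelationStableTail.DiffusiveBranchIsNonsaturation

open Filter Topology
open scoped BigOperators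
open Literature.Probability.LatticeModels

/-! ### Pointwise saturation -/

/-- **Pointwise saturation.** If `ε ≤ n G(n e₀)` for all `n ≥ N`, then `ε ≤ 3‖w‖_∞ G(w)` whenever
`N ≤ 3‖w‖_∞` (Messager–Miracle-Solé comparison `G(3‖w‖_∞ e₀) ≤ G(w)`,
`twoPointPlus_le_of_mul_supNorm_le`). [cite: MessagerMiracleSoleJSP1977, main theorem (monotonicity of ⟨σ₀σ_x⟩ under reflections)] -/
theorem nonSatHeavyTail_pointwise {ε : ℝ} {N : ℕ}
    (hsat : ∀ n : ℕ, N ≤ n → ε ≤ (n : ℝ) * criticalTwoPoint 3 (Pi.single 0 (n : ℤ)))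
    {w : Site 3} (hw : N ≤ 3 * Site.supNorm w) :
    ε ≤ 3 * (Site.supNorm w : ℝ) * criticalTwoPoint 3 w := by
  have h1 := hsat (3 * Site.supNorm w) hw
  have h2 : criticalTwoPoint 3 (Pi.single 0 ((3 * Site.supNorm w : ℕ) : ℤ)) ≤ criticalTwoPoint 3 w :=
    twoPointPlus_le_of_mul_supNorm_le (d := 3) (criticalBeta_nonneg 3)
      (MirrorHoelderCompactnessGlue.le_supNorm_single (3 * Site.supNorm w))
  have h3 : (0 : ℝ) ≤ ((3 * Site.supNorm w : ℕ) : ℝ) := by positivity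
  have h4 := mul_le_mul_of_nonneg_left h2 h3
  push_cast at h1 h4
  linarith

/-! ### The flux bound -/

/-- Summability of `y ↦ a(y) G(z − y)` for `a ∈ ℓ¹(ℤ³)` (`0 ≤ G ≤ 1`). [folklore] -/
theorem nonSatHeavyTail_summable_mul {a : Site 3 → ℝ} (ha : Summable a) (z : Site 3) :
    Summable (fun y => a y * criticalTwoPoint 3 (z - y)) := by
  refine Summable.of_norm_bounded ha.norm fun y => ?_
  rw [norm_mul]
  refine mul_le_of_le_one_right (norm_nonneg _) ?_
  rw [Real.norm_eq_abs, abs_of_nonneg (criticalTwoPoint_nonneg' _)]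
  exact criticalTwoPoint_le_one' _

/-- **Flux bound.** For `a ∈ ℓ¹(ℤ³)` with `Σ a = 0`, `a ≥ 0` off `0`, the precision identity
`Σ_y a(y) G(z − y) = −δ_{z0}` and box capture, every finite partial sum of the nonnegative series
`Σ_y a(y) (F_R(0) − F_R(−y)) = 1`, `F_R(w) = Σ_{z ∈ B_R} G(z + w)`, is at most `1`. [folklore] -/
theorem nonSatHeavyTail_flux {a : Site 3 → ℝ} (ha : Summable a) (hzero : (∑' y, a y) = 0)
    (hnn : ∀ y, y ≠ 0 → 0 ≤ a y)
    (hconv : ∀ z : Site 3,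
      (∑' y : Site 3, a y * criticalTwoPoint 3 (z - y)) = if z = 0 then -1 else 0)
    (hcap : ∀ (R : ℕ) (v : Site 3),
      ∑ z ∈ box 3 R, criticalTwoPoint 3 (z + v) ≤ ∑ z ∈ box 3 R, criticalTwoPoint 3 z)
    (R : ℕ) (T : Finset (Site 3)) :
    ∑ y ∈ T, a y * (∑ z ∈ box 3 R, criticalTwoPoint 3 z -
      ∑ z ∈ box 3 R, criticalTwoPoint 3 (z - y)) ≤ 1 := by
  classical
  have hs1 : Summable fun y => a y * ∑ z ∈ box 3 R, criticalTwoPoint 3 z := ha.mul_right _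
  have hs2 : Summable fun y => ∑ z ∈ box 3 R, a y * criticalTwoPoint 3 (z - y) :=
    summable_sum fun z _ => nonSatHeavyTail_summable_mul ha z
  have hpt : ∀ y, a y * (∑ z ∈ box 3 R, criticalTwoPoint 3 z -
      ∑ z ∈ box 3 R, criticalTwoPoint 3 (z - y)) =
      a y * ∑ z ∈ box 3 R, criticalTwoPoint 3 z - ∑ z ∈ box 3 R, a y * criticalTwoPoint 3 (z - y) :=
    fun y => by rw [mul_sub, sub_right_inj, Finset.mul_sum]
  have hs : Summable fun y => a y * (∑ z ∈ box 3 R, criticalTwoPoint 3 z -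
      ∑ z ∈ box 3 R, criticalTwoPoint 3 (z - y)) := by
    simp_rw [hpt]
    exact hs1.sub hs2
  have hval : ∑' y, a y * (∑ z ∈ box 3 R, criticalTwoPoint 3 z -
      ∑ z ∈ box 3 R, criticalTwoPoint 3 (z - y)) = 1 := by
    simp_rw [hpt]
    rw [hs1.tsum_sub hs2, tsum_mul_right, hzero, zero_mul,
      Summable.tsum_finsetSum fun z _ => nonSatHeavyTail_summable_mul ha z]
    simp_rw [hconv]
    simp [Finset.sum_ite_eq']
  have h0 : ∀ y, 0 ≤ a y * (∑ z ∈ box 3 R, criticalTwoPoint 3 z -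
      ∑ z ∈ box 3 R, criticalTwoPoint 3 (z - y)) := by
    intro y
    by_cases hy : y = 0
    · subst hy
      simp
    · refine mul_nonneg (hnn y hy) (sub_nonneg.2 ?_)
      have h := hcap R (-y)
      simp_rw [← sub_eq_add_neg] at h
      exact h
  calc ∑ y ∈ T, a y * (∑ z ∈ box 3 R, criticalTwoPoint 3 z -
        ∑ z ∈ box 3 R, criticalTwoPoint 3 (z - y))
      ≤ ∑' y, a y * (∑ z ∈ box 3 R, criticalTwoPoint 3 z -
        ∑ z ∈ box 3 R, criticalTwoPoint 3 (z - y)) := hs.sum_le_tsum T fun y _ => h0 y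
    _ = 1 := hval

/-! ### Lower bound on the box mass under saturation -/

/-- **Box mass under saturation.** If `ε ≤ n G(n e₀)` for all `n ≥ N` (`ε > 0`), then
`2 R² ε ≤ Σ_{z ∈ B_R} G(z)` for every `R ≥ 2N + 1`: on the shell `B_R ∖ B_N` (at least `7R³` sites)
`G ≥ ε/(3R)` by pointwise saturation. [folklore] -/
theorem nonSatHeavyTail_lower {ε : ℝ} (hε : 0 < ε) {N : ℕ}
    (hsat : ∀ n : ℕ, N ≤ n → ε ≤ (n : ℝ) * criticalTwoPoint 3 (Pi.single 0 (n : ℤ)))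
    {R : ℕ} (hR : 2 * N + 1 ≤ R) :
    2 * (R : ℝ) ^ 2 * ε ≤ ∑ z ∈ box 3 R, criticalTwoPoint 3 z := by
  have hRpos : (0 : ℝ) < R := by exact_mod_cast (show 0 < R by omega)
  have hNR : N ≤ R := by omega
  -- pointwise on the shell
  have hpt : ∀ z ∈ box 3 R \ box 3 N, ε ≤ 3 * (R : ℝ) * criticalTwoPoint 3 z := by
    intro z hz
    rw [Finset.mem_sdiff, mem_box_iff_supNorm_le, mem_box_iff_supNorm_le] at hz
    have h1 : N ≤ 3 * Site.supNorm z := by omega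
    have h2 := nonSatHeavyTail_pointwise hsat h1
    have h3 : (3 : ℝ) * (Site.supNorm z : ℝ) ≤ 3 * R := by
      have : (Site.supNorm z : ℝ) ≤ R := by exact_mod_cast hz.1
      linarith
    exact h2.trans (mul_le_mul_of_nonneg_right h3 (criticalTwoPoint_nonneg' z))
  -- the shell is large
  have hcard : 7 * (R : ℝ) ^ 3 ≤ ((box 3 R \ box 3 N).card : ℝ) := by
    have h1 : (box 3 R \ box 3 N).card + (2 * N + 1) ^ 3 = (2 * R + 1) ^ 3 := by
      rw [← card_box 3 N, ← card_box 3 R]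
      exact Finset.card_sdiff_add_card_eq_card (box_mono 3 hNR)
    have h2 : ((box 3 R \ box 3 N).card : ℝ) + (2 * (N : ℝ) + 1) ^ 3 = (2 * (R : ℝ) + 1) ^ 3 := by
      exact_mod_cast h1
    have h3 : (2 * (N : ℝ) + 1) ≤ R := by exact_mod_cast hR
    have h4 : (2 * (N : ℝ) + 1) ^ 3 ≤ (R : ℝ) ^ 3 := pow_le_pow_left₀ (by positivity) h3 3
    nlinarith [h2, h4, hRpos.le, sq_nonneg (R : ℝ)]
  -- sum over the shell
  have hsum : ((box 3 R \ box 3 N).card : ℝ) * ε ≤ 3 * R * ∑ z ∈ box 3 R, criticalTwoPoint 3 z := by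
    calc ((box 3 R \ box 3 N).card : ℝ) * ε = ∑ _z ∈ box 3 R \ box 3 N, ε := by
          rw [Finset.sum_const, nsmul_eq_mul]
      _ ≤ ∑ z ∈ box 3 R \ box 3 N, 3 * (R : ℝ) * criticalTwoPoint 3 z := Finset.sum_le_sum hpt
      _ = 3 * R * ∑ z ∈ box 3 R \ box 3 N, criticalTwoPoint 3 z := by rw [Finset.mul_sum]
      _ ≤ 3 * R * ∑ z ∈ box 3 R, criticalTwoPoint 3 z :=
          mul_le_mul_of_nonneg_left (Finset.sum_le_sum_of_subset_of_nonneg Finset.sdiff_subset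
            fun z _ _ => criticalTwoPoint_nonneg' z) (by positivity)
  have h7 : 7 * (R : ℝ) ^ 3 * ε ≤ 3 * R * ∑ z ∈ box 3 R, criticalTwoPoint 3 z :=
    (mul_le_mul_of_nonneg_right hcard hε.le).trans hsum
  have h8 : 3 * (R : ℝ) * (2 * (R : ℝ) ^ 2 * ε) ≤ 3 * R * ∑ z ∈ box 3 R, criticalTwoPoint 3 z := by
    nlinarith [h7, hRpos, hε]
  exact le_of_mul_le_mul_left h8 (by positivity)

/-! ### Far-field bound from the infrared ceiling -/

/-- **Infrared ceiling** `‖x‖_∞ G(x) ≤ C₁` (`x ≠ 0`) with `C₁ ≥ 0`, from the critical two-point upper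
bound `G(x) ≤ C ‖x‖^{−(d−2)}` at `d = 3` (`criticalTwoPoint_bounds_holds`). [cite: DuminilCopin2019, Thm. 4.8, §4.4] -/
theorem nonSatHeavyTail_ceiling :
    ∃ C₁ : ℝ, 0 ≤ C₁ ∧ ∀ x : Site 3, x ≠ 0 → (Site.supNorm x : ℝ) * criticalTwoPoint 3 x ≤ C₁ := by
  obtain ⟨c₀, C₀, -, hb⟩ := criticalTwoPoint_bounds_holds (d := 3) le_rfl
  refine ⟨max C₀ 0, le_max_right _ _, fun x hx => ?_⟩
  have h := (hb x hx).2
  have hpos : (0 : ℝ) < Site.supNorm x := by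
    have : Site.supNorm x ≠ 0 := fun h0 => hx (Site.supNorm_eq_zero_iff.1 h0)
    exact_mod_cast Nat.pos_of_ne_zero this
  have h32 : (-((3 : ℝ) - 2)) = (-1 : ℝ) := by norm_num
  rw [show ((3 : ℕ) : ℝ) = (3 : ℝ) by norm_num, h32, Site.norm_eq_supNorm, Real.rpow_neg_one] at h
  have h' : criticalTwoPoint 3 x ≤ max C₀ 0 * (Site.supNorm x : ℝ)⁻¹ :=
    h.trans (mul_le_mul_of_nonneg_right (le_max_left _ _) (inv_nonneg.2 hpos.le))
  rw [← div_eq_mul_inv, le_div_iff₀ hpos] at h'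
  rw [mul_comm]
  exact h'

/-- **Far-field bound.** If `‖x‖_∞ G(x) ≤ C₁` off `0`, then for `R ≥ 1`, `K ≥ 1` and
`‖y‖_∞ ≥ K R + 1`: `(K − 1) Σ_{z ∈ B_R} G(z − y) ≤ 27 R² C₁` (each `z − y` has `‖z − y‖_∞ ≥ (K−1)R + 1`,
and `|B_R| ≤ 27 R³`). [folklore] -/
theorem nonSatHeavyTail_far {C₁ : ℝ} (hC₁ : 0 ≤ C₁)
    (hceil : ∀ x : Site 3, x ≠ 0 → (Site.supNorm x : ℝ) * criticalTwoPoint 3 x ≤ C₁)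
    {R K : ℕ} (hR : 1 ≤ R) (hK : 1 ≤ K) {y : Site 3} (hy : K * R + 1 ≤ Site.supNorm y) :
    ((K : ℝ) - 1) * ∑ z ∈ box 3 R, criticalTwoPoint 3 (z - y) ≤ 27 * (R : ℝ) ^ 2 * C₁ := by
  have hRpos : (0 : ℝ) < R := by exact_mod_cast hR
  have hRK : R ≤ K * R := Nat.le_mul_of_pos_left R hK
  have hpt : ∀ z ∈ box 3 R, ((K : ℝ) - 1) * R * criticalTwoPoint 3 (z - y) ≤ C₁ := by
    intro z hz
    rw [mem_box_iff_supNorm_le] at hz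
    have htri : Site.supNorm y ≤ Site.supNorm (z - y) + Site.supNorm z := by
      have h := Site.supNorm_add_le (y - z) z
      rw [sub_add_cancel, ← neg_sub z y, Site.supNorm_neg] at h
      exact h
    have hge : K * R + 1 ≤ Site.supNorm (z - y) + R := by omega
    have hne : z - y ≠ 0 := by
      intro h0
      rw [h0, Site.supNorm_eq_zero_iff.2 rfl] at hge
      omega
    have hc := hceil (z - y) hne
    have hG := criticalTwoPoint_nonneg' (d := 3) (z - y)
    have hge' : ((K : ℝ) - 1) * R ≤ (Site.supNorm (z - y) : ℝ) := by
      have h1 : ((K * R + 1 : ℕ) : ℝ) ≤ ((Site.supNorm (z - y) + R : ℕ) : ℝ) := by exact_mod_cast hge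
      push_cast at h1
      linarith
    exact (mul_le_mul_of_nonneg_right hge' hG).trans hc
  have hsum : ((K : ℝ) - 1) * R * ∑ z ∈ box 3 R, criticalTwoPoint 3 (z - y) ≤
      ((box 3 R).card : ℝ) * C₁ := by
    rw [Finset.mul_sum]
    calc ∑ z ∈ box 3 R, ((K : ℝ) - 1) * R * criticalTwoPoint 3 (z - y)
        ≤ ∑ _z ∈ box 3 R, C₁ := Finset.sum_le_sum hpt
      _ = ((box 3 R).card : ℝ) * C₁ := by rw [Finset.sum_const, nsmul_eq_mul]
  have hcard : ((box 3 R).card : ℝ) ≤ 27 * (R : ℝ) ^ 3 := by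
    rw [card_box]
    push_cast
    have h1 : (1 : ℝ) ≤ R := by exact_mod_cast hR
    have h2 : (2 * (R : ℝ) + 1) ≤ 3 * R := by linarith
    calc (2 * (R : ℝ) + 1) ^ 3 ≤ (3 * (R : ℝ)) ^ 3 := pow_le_pow_left₀ (by positivity) h2 3
      _ = 27 * (R : ℝ) ^ 3 := by ring
  have h := hsum.trans (mul_le_mul_of_nonneg_right hcard hC₁)
  have e1 : ((K : ℝ) - 1) * R * ∑ z ∈ box 3 R, criticalTwoPoint 3 (z - y) =
      R * (((K : ℝ) - 1) * ∑ z ∈ box 3 R, criticalTwoPoint 3 (z - y)) := by ring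
  have e2 : 27 * (R : ℝ) ^ 3 * C₁ = R * (27 * (R : ℝ) ^ 2 * C₁) := by ring
  rw [e1, e2] at h
  exact le_of_mul_le_mul_left h hRpos

/-! ### The registered stub -/

/-- **Stub `stub_nonSaturationOfHeavyTail` (non-saturation from a heavy-tailed precision row; flux
argument).**  Let `a ∈ ℓ¹(ℤ³)`, `Σ a = 0`, `a ≥ 0` off `0`, `Σ_y a(y) G(z−y) = −δ_{z0}` for
`G = criticalTwoPoint 3`, box capture `Σ_{z∈B_R} G(z+v) ≤ Σ_{z∈B_R} G(z)`, and a shell mass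
`Σ_{y ∈ B_{2ρ} ∖ B_ρ} a(y) ≥ c ρ^{−κ}` (`ρ ≥ ρ₀`) with `κ < 2`, `c > 0`.  Then for every `ε > 0`,
frequently `n G(n e₀) < ε`.  Proof: if `n G(n e₀) ≥ ε` for all `n ≥ N`, the flux bound
`Σ_{y ∈ T} a(y)(F_R(0) − F_R(−y)) ≤ 1` on the shell `T = B_{2KR} ∖ B_{KR}`, the lower bound
`F_R(0) ≥ 2R²ε` and the far-field bound `(K−1) F_R(−y) ≤ 27R²C₁ ≤ (K−2)R²ε` give
`1 ≥ R²ε · c (KR)^{−κ} = (ε c K^{−κ}) R^{2−κ}`, impossible for large `R`. [cite: MessagerMiracleSoleJSP1977, main theorem (monotonicity of ⟨σ₀σ_x⟩ under reflections)] -/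
theorem stub_nonSaturationOfHeavyTail :
    ∀ (a : Site 3 → ℝ) (κ c : ℝ) (ρ₀ : ℕ), Summable a → (∑' y, a y) = 0 → (∀ y, y ≠ 0 → 0 ≤ a y) →
      (∀ z : Site 3, (∑' y : Site 3, a y * criticalTwoPoint 3 (z - y)) = if z = 0 then -1 else 0) →
      (∀ (R : ℕ) (v : Site 3), ∑ z ∈ box 3 R, criticalTwoPoint 3 (z + v) ≤
        ∑ z ∈ box 3 R, criticalTwoPoint 3 z) →
      κ < 2 → 0 < c → (∀ ρ : ℕ, ρ₀ ≤ ρ → c * (ρ : ℝ) ^ (-κ) ≤ ∑ y ∈ box 3 (2 * ρ) \ box 3 ρ, a y) →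
      ∀ ε : ℝ, 0 < ε →
        ∃ᶠ n : ℕ in Filter.atTop, (n : ℝ) * criticalTwoPoint 3 (Pi.single 0 (n : ℤ)) < ε := by
  intro a κ c ρ₀ ha hzero hnn hconv hcap hκ hc hmass ε hε
  rw [Filter.frequently_atTop]
  intro N
  by_contra hsat
  push Not at hsat
  -- the infrared ceiling and the far-field parameter `K`
  obtain ⟨C₁, hC₁, hceil⟩ := nonSatHeavyTail_ceiling
  obtain ⟨K, hK⟩ := exists_nat_ge (27 * C₁ / ε + 2)
  have hdiv : 0 ≤ 27 * C₁ / ε := by positivity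
  have hK2 : (2 : ℝ) ≤ K := by linarith
  have hK1 : 1 ≤ K := by exact_mod_cast (show (1 : ℝ) ≤ K by linarith)
  have hKpos : (0 : ℝ) < K := by linarith
  have hKC : 27 * C₁ ≤ ((K : ℝ) - 2) * ε := by
    have : 27 * C₁ / ε ≤ (K : ℝ) - 2 := by linarith
    rwa [div_le_iff₀ hε] at this
  -- the rate constant
  set A : ℝ := ε * c * (K : ℝ) ^ (-κ) with hA
  have hApos : 0 < A := by
    have : 0 < (K : ℝ) ^ (-κ) := Real.rpow_pos_of_pos hKpos _
    positivity
  -- a large radius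
  have hev1 : ∀ᶠ R : ℕ in atTop, A⁻¹ < (R : ℝ) ^ (2 - κ) := by
    have h := ((tendsto_rpow_atTop (by linarith : (0 : ℝ) < 2 - κ)).comp
      tendsto_natCast_atTop_atTop).eventually_gt_atTop A⁻¹
    filter_upwards [h] with R hR
    exact hR
  obtain ⟨R, hR1, hR2, hR3⟩ :=
    (hev1.and ((eventually_ge_atTop (2 * N + 1)).and (eventually_ge_atTop (ρ₀ + 1)))).exists
  have hR0 : 1 ≤ R := by omega
  have hRpos : (0 : ℝ) < R := by exact_mod_cast (show 0 < R by omega)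
  have hRK : R ≤ K * R := Nat.le_mul_of_pos_left R hK1
  have hρ₀ : ρ₀ ≤ K * R := by omega
  have hm := hmass (K * R) hρ₀
  set T : Finset (Site 3) := box 3 (2 * (K * R)) \ box 3 (K * R) with hT
  -- lower bound on `F_R(0)` and the gap `F_R(0) - F_R(-y) ≥ R² ε` on the shell
  have hlow := nonSatHeavyTail_lower hε hsat hR2
  have hdiff : ∀ y ∈ T, (R : ℝ) ^ 2 * ε ≤
      ∑ z ∈ box 3 R, criticalTwoPoint 3 z - ∑ z ∈ box 3 R, criticalTwoPoint 3 (z - y) := by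
    intro y hy
    rw [hT, Finset.mem_sdiff, mem_box_iff_supNorm_le, mem_box_iff_supNorm_le] at hy
    have hy' : K * R + 1 ≤ Site.supNorm y := by omega
    have hfar := nonSatHeavyTail_far hC₁ hceil hR0 hK1 hy'
    have hK1' : (0 : ℝ) < (K : ℝ) - 1 := by linarith
    have hR2ε : (0 : ℝ) ≤ (R : ℝ) ^ 2 * ε := by positivity
    have h27 : 27 * (R : ℝ) ^ 2 * C₁ ≤ ((K : ℝ) - 2) * ε * (R : ℝ) ^ 2 :=
      by nlinarith [hKC, sq_nonneg (R : ℝ)]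
    have p1 := mul_le_mul_of_nonneg_left hlow hK1'.le
    have key : ((K : ℝ) - 1) * ((R : ℝ) ^ 2 * ε) ≤ ((K : ℝ) - 1) *
        (∑ z ∈ box 3 R, criticalTwoPoint 3 z - ∑ z ∈ box 3 R, criticalTwoPoint 3 (z - y)) := by
      nlinarith [p1, hfar, h27, hR2ε]
    exact le_of_mul_le_mul_left key hK1'
  -- `a ≥ 0` on the shell
  have hTa : ∀ y ∈ T, 0 ≤ a y := by
    intro y hy
    rw [hT, Finset.mem_sdiff, mem_box_iff_supNorm_le, mem_box_iff_supNorm_le] at hy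
    refine hnn y fun h0 => ?_
    rw [h0, Site.supNorm_eq_zero_iff.2 rfl] at hy
    omega
  -- the flux bound on the shell
  have hflux := nonSatHeavyTail_flux ha hzero hnn hconv hcap R T
  have hchain : (R : ℝ) ^ 2 * ε * (c * ((K * R : ℕ) : ℝ) ^ (-κ)) ≤ 1 := by
    calc (R : ℝ) ^ 2 * ε * (c * ((K * R : ℕ) : ℝ) ^ (-κ))
        ≤ (R : ℝ) ^ 2 * ε * ∑ y ∈ T, a y := mul_le_mul_of_nonneg_left hm (by positivity)
      _ = ∑ y ∈ T, a y * ((R : ℝ) ^ 2 * ε) := by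
          rw [Finset.mul_sum]
          exact Finset.sum_congr rfl fun y _ => mul_comm _ _
      _ ≤ ∑ y ∈ T, a y * (∑ z ∈ box 3 R, criticalTwoPoint 3 z -
            ∑ z ∈ box 3 R, criticalTwoPoint 3 (z - y)) :=
          Finset.sum_le_sum fun y hy => mul_le_mul_of_nonneg_left (hdiff y hy) (hTa y hy)
      _ ≤ 1 := hflux
  have hLHS : (R : ℝ) ^ 2 * ε * (c * ((K * R : ℕ) : ℝ) ^ (-κ)) = A * (R : ℝ) ^ (2 - κ) := by
    rw [Nat.cast_mul, Real.mul_rpow hKpos.le hRpos.le, hA, sub_eq_add_neg, Real.rpow_add hRpos,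
      Real.rpow_two]
    ring
  rw [hLHS] at hchain
  have hgt : 1 < A * (R : ℝ) ^ (2 - κ) := by
    have h := mul_lt_mul_of_pos_left hR1 hApos
    rwa [mul_inv_cancel₀ hApos.ne'] at h
  linarith

end Summit.CriticalPhenomena.Ising3DConformalLimit.Cruxes.DirectCorrelationStableTail.DiffusiveBranchIsNonsaturation

end
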